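import Literature.NumberTheory.Transcendental.KZIdealTetrahedron
import Literature.NumberTheory.Transcendental.KZLogCalculusProofs
import Summits.KontsevichZagierPeriods.KontsevichZagierPeriods.Theorems.FiveTermTransfer.Negative.LoadBearing
import Summits.KontsevichZagierPeriods.KontsevichZagierPeriods.Theorems.FiveTermTransfer.Negative.Inversion

/-!
# `FiveTermTransfer` (stmt-KontsevichZagierPeriods-3469) — line `valuation-kernel-sweep`,
stub `stub_inversionRelation`

For every standard family `ρ` (on the algebraic upper half plane `ρ z` is a representation
`[T(z), t⁻³]` on the ideal tetrahedron `T(z) = idealTetrahedron z`) and its signed class map `B`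
(`[ρ z]` on the upper half plane, `−[ρ z̄]` on the lower half plane, `0` on the real line), and
every algebraic `w`, the element `B w + B w⁻¹` is a relation of the Kontsevich–Zagier calculus.

For `Im w > 0` it is `[ρ w] − [ρ (1/w̄)]`, i.e. (after swapping `ρ` for the tree's
`idealTetrahedronRep` at both ends by congruence) ONE change-of-variables generator: inversion in
the unit sphere `p ↦ p/|p|²` carries `T(w)` onto `T(1/w̄)` with `|det| = |p|⁻⁶` absorbed by `t⁻³`
(`Negative/Inversion.lean`, `inversion_mem_relations`); the lower half plane follows by
conjugation and the real line trivially. All of this is the tree's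
`fiveTerm_one_right_mem_relations` read through `fiveTerm_one_right :
fiveTerm (signedClass ρ) x 1 = signedClass ρ x + signedClass ρ x⁻¹`. [folklore]
-/

noncomputable section

open MeasureTheory Set Complex
open scoped ComplexConjugate

namespace Summit.KontsevichZagierPeriods.HyperbolicBloch.FiveTerm

open Literature.NumberTheory.Transcendental
open Literature.NumberTheory.Transcendental.KZ
open Summit.KontsevichZagierPeriods.HyperbolicBloch.FiveTermTransferNegative

/-- **Inversion relation.** For a standard family `ρ`, its signed class map `B` and an algebraic
`w`, `B w + B w⁻¹ ∈ KZ.relations`: on the upper half plane this is `[T(w)] − [T(1/w̄)]`, one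
change-of-variables move (inversion in the unit sphere `p ↦ p/|p|²`, `|det| = |p|⁻⁶`,
`t⁻³ = (t/|p|²)⁻³ · |p|⁻⁶`); the lower half plane by conjugation, the real line trivially
(`Negative/Inversion.lean`, `fiveTerm_one_right_mem_relations`). [folklore] -/
theorem stub_inversionRelation :
    ∀ (ρ : ℂ → KZ.IntegralRep 3),
      (∀ z, IsAlgebraic ℚ z → 0 < z.im → (ρ z).domain = idealTetrahedron z ∧
        Set.EqOn (ρ z).integrand (fun p => 1 / p 2 ^ 3) (idealTetrahedron z)) →
    ∀ (B : ℂ → KZ.FormalRep),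
      (∀ z, B z = if 0 < z.im then KZ.of (ρ z)
        else if z.im < 0 then -KZ.of (ρ ((starRingEnd ℂ) z)) else 0) →
    ∀ w : ℂ, IsAlgebraic ℚ w → B w + B w⁻¹ ∈ KZ.relations := by
  intro ρ hρ B hB w hw
  have hρ' : IsStandardOn ρ := hρ
  have hB' : B = signedClass ρ := funext fun z => hB z
  rw [hB', ← fiveTerm_one_right]
  exact fiveTerm_one_right_mem_relations hρ' hw

end Summit.KontsevichZagierPeriods.HyperbolicBloch.FiveTerm

end
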